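import Summits.KontsevichZagierPeriods.KontsevichZagierPeriods.Theorems.PlanarAreas.Negative.GreenBandsLoadBearingV3
import Summits.KontsevichZagierPeriods.KontsevichZagierPeriods.Theorems.PlanarAreas.Negative.GreenBandsBulkLoadBearing
import Summits.KontsevichZagierPeriods.KontsevichZagierPeriods.Theorems.RealOnePeriodRelations.Negative.Kit
import Literature.Barriers.KontsevichZagierPeriods.AlgebraicPrimitivesObstruction

/-!
# `PlanarAreas` (stmt-KontsevichZagierPeriods-4990), line `green-native-bands`: load-bearing
# hypotheses of the three OPEN stubs, second refuter generation (negative lemmas)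

Refuter unit `drefute-stmt-KontsevichZagierPeriods-4990-g2` on the lead's skeleton v3
(`Cruxes/PlanarAreas/Lines/green-native-bands.lean`, sha 495091be93cf, stubs registered
2026-08-16T02:23Z). Four of its seven stubs have landed (`Theorems/SymplecticScissorsPlanarAreasStub
{AreaSlicing,FibreDerivSemialgebraic,MixedPartials,Swap}.lean`); the three open ones are the engine
`stub_bandNewtonLeibniz`, the analytic heart `stub_derivIntegrable` and the glue `stub_greenInRelations`.
All three are TRUE on paper (first generation: `GreenBandsLoadBearing*.lean`, `GreenBandsBulkLoadBearing.lean`,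
`GreenBandsPeano.lean`). This file adds three kernel-checked MUTATIONS not covered there, one per open stub:

* `not_bandNLv3WithoutSemialgebraicF` — the engine with the hypothesis
  `IsSemialgebraicFunOn ℚ r.domain F` (the PRIMITIVE is semialgebraic) deleted is FALSE, and for a
  reason of a NEW kind: not by soundness (the two values agree) but because the base representation
  `[(a₀,a₁), F(·,β) − F(·,α)]` need not EXIST as a KZ representation. Witness: the closed unit square,
  `F(t,s) = −log (2 − t s)` (bounded, fibrewise analytic), integrand `∂ₛF = t/(2 − t s)`
  (`ℚ`-rational, bounded): the base integrand would be `log 2 − log (2 − t)`, a `ℚ`-semialgebraic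
  primitive of `1/(2 − t)` on `(0,1)` — excluded by the tree's BARRIER
  `Literature.Barriers.KontsevichZagierPeriods.KZ.noSemialgebraicPrimitive_inv_sub_two_holds`
  (Ayoub 2015, Rem. 1.2; Fresán 2024, Rem. 3.6). This is the line card's barrier story made formal at
  stub level: rule 3 only ever differentiates a GIVEN semialgebraic datum; a transcendental primitive
  cannot be fed to the engine even when its derivative is rational.
* `not_derivIntegrableInteriorContinuity` — in `stub_derivIntegrable` the hypothesis `ContinuousOn A Δ`
  (CLOSED triangle) cannot be weakened to continuity on the OPEN triangle: the first generation's
  witness `A = 1/y` is continuous inside. (With boundedness added back the statement is again true on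
  paper: what the total-variation argument consumes is `‖A‖_∞ < ∞`, i.e. continuity up to `∂Δ` only
  through compactness.)
* `not_greenInteriorContinuity` — in `stub_greenInRelations` (i.e. in the typed Green generator
  `greenSet` of crux stmt-10042) the continuity of the coefficients `A, B` on the CLOSED triangle cannot
  be weakened to continuity on the open triangle plus boundedness: the three edge representations read
  the boundary VALUES of `A, B`, and the jump `A = 𝟙{b = 0}` (zero inside, potential `S = 0`) gives the
  generator `[∫₀¹ 1] + [∫₀¹ 0] − [∫₀¹ 0]` of value `1`, not a relation by soundness.

References: M. Kontsevich, D. Zagier, *Periods* (2001), §1.2; J. Ayoub, *Une version relative de la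
conjecture des périodes de Kontsevich–Zagier*, Ann. of Math. 181 (2015), Rem. 1.2; J. Fresán,
*Une introduction aux périodes* (2024), Rem. 3.6–3.7.
-/

noncomputable section

open Set MeasureTheory MvPolynomial Filter Topology
open Literature.NumberTheory.Transcendental Literature.ModelTheory.ExponentialFields
open Summit.KontsevichZagierPeriods.SymplecticScissors.RealOnePeriodRelationsNegative
  (constRep₁ constRep₁_domain constRep₁_integrand value_constRep₁ unitDom)

namespace Summit.KontsevichZagierPeriods.PlanarAreas.Negative.GreenBands

/-! ## (1) The engine: semialgebraicity of the primitive `F` is load-bearing (via the barrier) -/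

/-- v3 `stub_bandNewtonLeibniz` with the hypothesis `IsSemialgebraicFunOn ℚ r.domain F` DELETED
(everything else verbatim). -/
def BandNLv3WithoutSemialgebraicF : Prop := ∀ (a₀ a₁ : ℚ) (α β : ℝ → ℝ) (F : (Fin 2 → ℝ) → ℝ)
    (Z : Set (Fin 2 → ℝ)) (r : KZ.IntegralRep 2), a₀ < a₁ →
    IsSemialgebraicFunOn ℚ {z : Fin 1 → ℝ | z 0 ∈ Set.Ioo (a₀ : ℝ) a₁} (fun z => α (z 0)) →
    IsSemialgebraicFunOn ℚ {z : Fin 1 → ℝ | z 0 ∈ Set.Ioo (a₀ : ℝ) a₁} (fun z => β (z 0)) →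
    (∀ t ∈ Set.Ioo (a₀ : ℝ) a₁, α t ≤ β t) →
    r.domain = {p : Fin 2 → ℝ | p 0 ∈ Set.Icc (a₀ : ℝ) a₁ ∧ α (p 0) ≤ p 1 ∧ p 1 ≤ β (p 0)} →
    (∃ M : ℝ, ∀ p ∈ r.domain, |F p| ≤ M) →
    (∀ t ∈ Set.Ioo (a₀ : ℝ) a₁, ContinuousOn (fun s : ℝ => F ![t, s]) (Set.Icc (α t) (β t))) →
    IsSemialgebraic ℚ Z → volume Z = 0 →
    (∀ p ∈ r.domain, p 0 ∈ Set.Ioo (a₀ : ℝ) a₁ → α (p 0) < p 1 → p 1 < β (p 0) → p ∉ Z →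
      HasDerivAt (fun s : ℝ => F ![p 0, s]) (r.integrand p) (p 1)) →
    ∃ r' : KZ.IntegralRep 1, r'.domain = {z : Fin 1 → ℝ | z 0 ∈ Set.Ioo (a₀ : ℝ) a₁} ∧
      (∀ z ∈ r'.domain, r'.integrand z = F ![z 0, β (z 0)] - F ![z 0, α (z 0)]) ∧
      KZ.of r - KZ.of r' ∈ KZ.relations

/-- The transcendental primitive `F(t,s) = −log (2 − t s)`. -/
def logF : (Fin 2 → ℝ) → ℝ := fun p => -Real.log (2 - p 0 * p 1)

/-- Its vertical derivative `∂ₛF (t,s) = t / (2 − t s)`, a `ℚ`-rational function. -/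
def logF' : (Fin 2 → ℝ) → ℝ := fun p => p 0 / (2 - p 0 * p 1)

/-- On the closed unit square `1 ≤ 2 − t s`. -/
theorem one_le_two_sub_mul {p : Fin 2 → ℝ} (hp : p ∈ closedSquareSet) : 1 ≤ 2 - p 0 * p 1 := by
  obtain ⟨h0, h1, h2, h3⟩ := hp
  nlinarith

/-- `logF'` is `ℚ`-semialgebraic on the closed unit square. -/
theorem isSemialgebraicFunOn_logF' : IsSemialgebraicFunOn ℚ closedSquareSet logF' := by
  refine (isSemialgebraicFunOn_aeval_div_aeval isSemialgebraic_closedSquareSet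
    (X 0 : MvPolynomial (Fin 2) ℚ) (C 2 - X 0 * X 1) fun x hx => ?_).congr fun x _ => ?_
  · have h := one_le_two_sub_mul hx
    have e : aeval x (C 2 - X 0 * X 1 : MvPolynomial (Fin 2) ℚ) = 2 - x 0 * x 1 := by simp
    rw [e]
    exact ne_of_gt (lt_of_lt_of_le one_pos h)
  · simp [logF']

/-- `logF'` is measurable. -/
theorem measurable_logF' : Measurable logF' :=
  (measurable_pi_apply 0).div (measurable_const.sub ((measurable_pi_apply 0).mul (measurable_pi_apply 1)))

/-- `0 ≤ logF' ≤ 1` on the closed unit square. -/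
theorem abs_logF'_le {p : Fin 2 → ℝ} (hp : p ∈ closedSquareSet) : |logF' p| ≤ 1 := by
  have h := one_le_two_sub_mul hp
  obtain ⟨h0, h1, -, -⟩ := hp
  have hpos : 0 < 2 - p 0 * p 1 := lt_of_lt_of_le one_pos h
  rw [logF', abs_of_nonneg (div_nonneg h0 hpos.le), div_le_one hpos]
  linarith

/-- `[[0,1]², t/(2 − t s)]`: the closed unit square with the rational integrand `∂ₛ logF`. -/
def logSquare : KZ.IntegralRep 2 where
  domain := closedSquareSet
  integrand := logF'
  isSemialgebraic_domain := isSemialgebraic_closedSquareSet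
  isSemialgebraicFunOn_integrand := isSemialgebraicFunOn_logF'
  integrableOn := by
    refine Measure.integrableOn_of_bounded (M := 1) (by simp [volume_closedSquareSet])
      measurable_logF'.aestronglyMeasurable ?_
    rw [ae_restrict_iff' (by rw [closedSquareSet_eq_Icc]; exact measurableSet_Icc)]
    exact Filter.Eventually.of_forall fun p hp => by
      rw [Real.norm_eq_abs]; exact abs_logF'_le hp

/-- The two end points `{x | x 0 = 0 ∨ x 0 = 1} ⊂ ℝ¹` form a `ℚ`-semialgebraic set. -/
theorem isSemialgebraic_endSet : IsSemialgebraic ℚ {x : Fin 1 → ℝ | x 0 = 0 ∨ x 0 = 1} := by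
  have h0 := isSemialgebraic_setOf_eval_eq_zero (k := ℚ) (R := ℝ) (ι := Fin 1) (X 0)
  have h1 := isSemialgebraic_setOf_eval_eq_zero (k := ℚ) (R := ℝ) (ι := Fin 1) (X 0 - C 1)
  convert h0.union h1 using 1
  ext x
  simp [sub_eq_zero]

/-- **Semialgebraicity of the primitive `F` is load-bearing in the v3 engine.** Delete it and feed
the engine the closed unit square (`α = 0`, `β = 1`), `F(t,s) = −log(2 − t s)` (`|F| ≤ 1`, analytic
on every fibre), `Z = ∅`, integrand `t/(2 − t s)`: the base representation it returns has integrand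
`log 2 − log (2 − t)` on `(0,1)`, so `t ↦ log (2 − t) − log 2`, extended by `0` to the end points, is a
`ℚ`-semialgebraic function on `[0,1]` with derivative `1/(t − 2)` on `(0,1)` — contradicting the
barrier `noSemialgebraicPrimitive_inv_sub_two_holds`. (The values DO agree: this deletion is not
caught by soundness; it is caught by the class of admissible data.) -/
theorem not_bandNLv3WithoutSemialgebraicF : ¬ BandNLv3WithoutSemialgebraicF := by
  intro h
  have hb : IsSemialgebraic ℚ {z : Fin 1 → ℝ | z 0 ∈ Set.Ioo ((0 : ℚ) : ℝ) ((1 : ℚ) : ℝ)} :=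
    isSemialgebraic_baseSet
  have hα : IsSemialgebraicFunOn ℚ {z : Fin 1 → ℝ | z 0 ∈ Set.Ioo ((0 : ℚ) : ℝ) ((1 : ℚ) : ℝ)}
      (fun z => (fun _ : ℝ => (0 : ℝ)) (z 0)) := by
    simpa using isSemialgebraicFunOn_natCast hb 0
  have hβ : IsSemialgebraicFunOn ℚ {z : Fin 1 → ℝ | z 0 ∈ Set.Ioo ((0 : ℚ) : ℝ) ((1 : ℚ) : ℝ)}
      (fun z => (fun _ : ℝ => (1 : ℝ)) (z 0)) := by
    simpa using isSemialgebraicFunOn_natCast hb 1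
  have hbd : ∃ M : ℝ, ∀ p ∈ logSquare.domain, |logF p| ≤ M := by
    refine ⟨1, fun p hp => ?_⟩
    have h1 := one_le_two_sub_mul hp
    obtain ⟨h0, h0', h2, h3⟩ := hp
    have hle : 2 - p 0 * p 1 ≤ 2 := by nlinarith
    have hlog0 : 0 ≤ Real.log (2 - p 0 * p 1) := Real.log_nonneg h1
    have hlog1 : Real.log (2 - p 0 * p 1) ≤ 1 := by
      have := Real.log_le_sub_one_of_pos (lt_of_lt_of_le one_pos h1)
      linarith
    rw [logF, abs_neg, abs_of_nonneg hlog0]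
    exact hlog1
  have hcont : ∀ t ∈ Set.Ioo (((0 : ℚ)) : ℝ) ((1 : ℚ) : ℝ),
      ContinuousOn (fun s : ℝ => logF ![t, s]) (Set.Icc ((fun _ : ℝ => (0 : ℝ)) t) ((fun _ : ℝ => (1 : ℝ)) t)) := by
    intro t ht
    have ht' : 0 < t ∧ t < 1 := by simpa using ht
    have e : (fun s : ℝ => logF ![t, s]) = fun s => -Real.log (2 - t * s) := by
      funext s; simp [logF]
    rw [e]
    refine ContinuousOn.neg (ContinuousOn.log (continuousOn_const.sub (continuousOn_const.mul continuousOn_id))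
      fun s hs => ?_)
    have hs' : 0 ≤ s ∧ s ≤ 1 := by simpa using hs
    nlinarith
  have hder : ∀ p ∈ logSquare.domain, p 0 ∈ Set.Ioo (((0 : ℚ)) : ℝ) ((1 : ℚ) : ℝ) →
      (fun _ : ℝ => (0 : ℝ)) (p 0) < p 1 → p 1 < (fun _ : ℝ => (1 : ℝ)) (p 0) → p ∉ (∅ : Set (Fin 2 → ℝ)) →
      HasDerivAt (fun s : ℝ => logF ![p 0, s]) (logSquare.integrand p) (p 1) := by
    intro p hp _ _ _ _
    have h1 := one_le_two_sub_mul hp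
    have hne : (2 : ℝ) - p 0 * p 1 ≠ 0 := ne_of_gt (lt_of_lt_of_le one_pos h1)
    have e : (fun s : ℝ => logF ![p 0, s]) = fun s => -Real.log (2 - p 0 * s) := by
      funext s; simp [logF]
    rw [e]
    have hd : HasDerivAt (fun s : ℝ => 2 - p 0 * s) (-(p 0 * 1)) (p 1) :=
      ((hasDerivAt_id (p 1)).const_mul (p 0)).const_sub 2
    refine ((hd.log hne).neg).congr_deriv ?_
    show -(-(p 0 * 1) / (2 - p 0 * p 1)) = logF' p
    rw [logF']
    ring
  obtain ⟨r', hd, hi, -⟩ := h 0 1 (fun _ => 0) (fun _ => 1) logF ∅ logSquare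
    zero_lt_one hα hβ (fun t _ => zero_le_one) closedSquareSet_eq_band hbd hcont
    isSemialgebraic_empty measure_empty hder
  -- the base integrand, negated and extended by `0` to the end points
  have hd' : r'.domain = baseSet := by rw [hd]; rfl
  set G : (Fin 1 → ℝ) → ℝ := baseSet.indicator fun x => -r'.integrand x with hG
  have hGsa : IsSemialgebraicFunOn ℚ {x : Fin 1 → ℝ | x 0 ∈ Icc (0 : ℝ) 1} G := by
    have hU : baseSet ∪ {x : Fin 1 → ℝ | x 0 = 0 ∨ x 0 = 1} = {x : Fin 1 → ℝ | x 0 ∈ Icc (0 : ℝ) 1} := by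
      ext x
      simp only [baseSet_eq, mem_union, mem_setOf_eq, mem_Icc]
      constructor
      · rintro (⟨h0, h1⟩ | h | h)
        · exact ⟨h0.le, h1.le⟩
        · rw [h]; exact ⟨le_rfl, zero_le_one⟩
        · rw [h]; exact ⟨zero_le_one, le_rfl⟩
      · rintro ⟨h0, h1⟩
        rcases h0.lt_or_eq with h0 | h0
        · rcases h1.lt_or_eq with h1 | h1
          · exact Or.inl ⟨h0, h1⟩
          · exact Or.inr (Or.inr h1)
        · exact Or.inr (Or.inl h0.symm)
    rw [← hU]
    have h1 : IsSemialgebraicFunOn ℚ baseSet (fun x => -r'.integrand x) := by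
      have := r'.isSemialgebraicFunOn_integrand.neg
      rw [hd'] at this
      exact this
    have h2 : IsSemialgebraicFunOn ℚ {x : Fin 1 → ℝ | x 0 = 0 ∨ x 0 = 1} (fun _ => (0 : ℝ)) := by
      simpa using isSemialgebraicFunOn_natCast isSemialgebraic_endSet 0
    refine h1.union h2 (fun x hx => by rw [hG, indicator_of_mem hx]) (fun x hx => ?_)
    have hx' : x ∉ baseSet := by
      rw [baseSet_eq]
      rintro ⟨h0, h1⟩
      rcases hx with h | h
      · rw [h] at h0; exact lt_irrefl _ h0
      · rw [h] at h1; exact lt_irrefl _ h1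
    rw [hG, indicator_of_notMem hx']
  have hGder : ∀ t ∈ Ioo (0 : ℝ) 1, HasDerivAt (fun s : ℝ => G (fun _ => s)) (1 / (t - 2)) t := by
    intro t ht
    have h2 : (2 : ℝ) - t ≠ 0 := by intro h'; linarith [ht.2]
    have hlog : HasDerivAt (fun s : ℝ => Real.log (2 - s) - Real.log 2) ((-1) / (2 - t)) t := by
      have := ((hasDerivAt_id t).const_sub 2).log h2
      simpa using this.sub_const (Real.log 2)
    have hval : (1 : ℝ) / (t - 2) = (-1) / (2 - t) := by
      rw [show t - 2 = -(2 - t) by ring, div_neg, neg_div]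
    rw [hval]
    refine hlog.congr_of_eventuallyEq ?_
    filter_upwards [Ioo_mem_nhds ht.1 ht.2] with s hs
    have hsb : (fun _ : Fin 1 => s) ∈ baseSet := by rw [baseSet_eq]; exact hs
    have hsd : (fun _ : Fin 1 => s) ∈ r'.domain := by rw [hd']; exact hsb
    rw [hG, indicator_of_mem hsb, hi _ hsd]
    simp [logF]
    ring
  exact Literature.Barriers.KontsevichZagierPeriods.KZ.noSemialgebraicPrimitive_inv_sub_two_holds
    ⟨G, hGsa, hGder⟩

/-! ## (2) `stub_derivIntegrable`: continuity up to the boundary cannot be weakened to the interior -/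

/-- `stub_derivIntegrable` with `ContinuousOn A Δ` (closed triangle) WEAKENED to continuity on the
open triangle (everything else verbatim). -/
def DerivIntegrableInteriorContinuity : Prop := ∀ A : (Fin 2 → ℝ) → ℝ,
    IsSemialgebraicFunOn ℚ {p : Fin 2 → ℝ | 0 ≤ p 0 ∧ 0 ≤ p 1 ∧ p 0 + p 1 ≤ 1} A →
    ContinuousOn A {p : Fin 2 → ℝ | 0 < p 0 ∧ 0 < p 1 ∧ p 0 + p 1 < 1} →
    IsSemialgebraicFunOn ℚ {p : Fin 2 → ℝ | 0 ≤ p 0 ∧ 0 ≤ p 1 ∧ p 0 + p 1 ≤ 1}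
      (fun p => if 0 < p 0 ∧ 0 < p 1 ∧ p 0 + p 1 < 1
        then deriv (fun s : ℝ => A ![p 0, s]) (p 1) else 0) →
    IntegrableOn (fun p => if 0 < p 0 ∧ 0 < p 1 ∧ p 0 + p 1 < 1
        then deriv (fun s : ℝ => A ![p 0, s]) (p 1) else 0)
      {p : Fin 2 → ℝ | 0 ≤ p 0 ∧ 0 ≤ p 1 ∧ p 0 + p 1 ≤ 1} volume

/-- `A = 1/y` is continuous on the open triangle. -/
theorem continuousOn_invY_open :
    ContinuousOn invY {p : Fin 2 → ℝ | 0 < p 0 ∧ 0 < p 1 ∧ p 0 + p 1 < 1} :=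
  (continuous_apply 1).continuousOn.inv₀ fun _ hp => hp.2.1.ne'

/-- **Interior continuity does not suffice in `stub_derivIntegrable`**: `A = 1/y` is
`ℚ`-semialgebraic on `Δ`, continuous on the open triangle, its bulk `∂_b A = −1/y²` (extended by `0`)
is `ℚ`-semialgebraic on `Δ` and not integrable. What the stub consumes is boundedness of `A` on `Δ`. -/
theorem not_derivIntegrableInteriorContinuity : ¬ DerivIntegrableInteriorContinuity := by
  intro h
  have h1 := h invY isSemialgebraicFunOn_invY continuousOn_invY_open
    (by rw [bulk_invY_eq]; exact isSemialgebraicFunOn_bulk_invY)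
  rw [bulk_invY_eq] at h1
  exact not_integrableOn_bulk_invY h1

/-! ## (3) `stub_greenInRelations`: boundary continuity of the Green coefficients is load-bearing -/

/-- `stub_greenInRelations` with the membership `g ∈ greenSet` unfolded and the clause
`ContinuousOn A Δ ∧ ContinuousOn B Δ` of `greenSet` WEAKENED to continuity on the open triangle plus
boundedness on `Δ` (everything else verbatim from `RealOnePeriodRelationsNegative.greenSet`). -/
def GreenInteriorContinuity : Prop := ∀ g : KZ.FormalRep,
    (∃ (Δ : Set (Fin 2 → ℝ)) (A B S : (Fin 2 → ℝ) → ℝ) (r₀₁ r₁₂ r₀₂ : KZ.IntegralRep 1),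
      Δ = {p | 0 ≤ p 0 ∧ 0 ≤ p 1 ∧ p 0 + p 1 ≤ 1} ∧ IsSemialgebraicFunOn ℚ Δ A ∧ IsSemialgebraicFunOn ℚ Δ B ∧
      ContinuousOn A {p : Fin 2 → ℝ | 0 < p 0 ∧ 0 < p 1 ∧ p 0 + p 1 < 1} ∧
      ContinuousOn B {p : Fin 2 → ℝ | 0 < p 0 ∧ 0 < p 1 ∧ p 0 + p 1 < 1} ∧
      (∃ M : ℝ, ∀ p ∈ Δ, |A p| ≤ M ∧ |B p| ≤ M) ∧
      (∀ p : Fin 2 → ℝ, 0 < p 0 → 0 < p 1 → p 0 + p 1 < 1 →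
        HasFDerivAt S (A p • ContinuousLinearMap.proj (R := ℝ) (φ := fun _ : Fin 2 => ℝ) 0 +
          B p • ContinuousLinearMap.proj (R := ℝ) (φ := fun _ : Fin 2 => ℝ) 1) p) ∧
      r₀₁.domain = {z | z 0 ∈ Set.Ioo 0 1} ∧ r₁₂.domain = {z | z 0 ∈ Set.Ioo 0 1} ∧
      r₀₂.domain = {z | z 0 ∈ Set.Ioo 0 1} ∧ (∀ z ∈ r₀₁.domain, r₀₁.integrand z = A ![z 0, 0]) ∧
      (∀ z ∈ r₁₂.domain, r₁₂.integrand z = B ![1 - z 0, z 0] - A ![1 - z 0, z 0]) ∧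
      (∀ z ∈ r₀₂.domain, r₀₂.integrand z = B ![0, z 0]) ∧ g = KZ.of r₀₁ + KZ.of r₁₂ - KZ.of r₀₂) →
    g ∈ KZ.relations

/-- The bottom-edge jump `A = 𝟙{b ≤ 0}` (equal to `𝟙{b = 0}` on `Δ`). -/
def jumpA : (Fin 2 → ℝ) → ℝ := fun p => if 0 < p 1 then 0 else 1

/-- `jumpA` is `ℚ`-semialgebraic on the closed triangle (two constant pieces). -/
theorem isSemialgebraicFunOn_jumpA :
    IsSemialgebraicFunOn ℚ {p : Fin 2 → ℝ | 0 ≤ p 0 ∧ 0 ≤ p 1 ∧ p 0 + p 1 ≤ 1} jumpA := by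
  set T : Set (Fin 2 → ℝ) := {p : Fin 2 → ℝ | 0 ≤ p 0 ∧ 0 ≤ p 1 ∧ p 0 + p 1 ≤ 1} with hT
  have hTs : IsSemialgebraic ℚ T := isSemialgebraic_closedTriangle'
  have hpos : IsSemialgebraic ℚ {x : Fin 2 → ℝ | 0 < x 1} := by
    simpa using isSemialgebraic_setOf_eval_lt (k := ℚ) (R := ℝ) (ι := Fin 2) (C 0) (X 1)
  have hle : IsSemialgebraic ℚ {x : Fin 2 → ℝ | x 1 ≤ 0} := by
    simpa using isSemialgebraic_setOf_eval_le (k := ℚ) (R := ℝ) (ι := Fin 2) (X 1) (C 0)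
  have h1 : IsSemialgebraicFunOn ℚ (T ∩ {x : Fin 2 → ℝ | 0 < x 1}) (fun _ => (0 : ℝ)) := by
    simpa using isSemialgebraicFunOn_natCast (hTs.inter hpos) 0
  have h2 : IsSemialgebraicFunOn ℚ (T ∩ {x : Fin 2 → ℝ | x 1 ≤ 0}) (fun _ => (1 : ℝ)) := by
    simpa using isSemialgebraicFunOn_natCast (hTs.inter hle) 1
  have hU : T ∩ {x : Fin 2 → ℝ | 0 < x 1} ∪ T ∩ {x : Fin 2 → ℝ | x 1 ≤ 0} = T := by
    rw [← inter_union_distrib_left]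
    refine inter_eq_left.mpr fun x _ => ?_
    simp only [mem_union, mem_setOf_eq]
    exact lt_or_ge 0 (x 1)
  rw [← hU]
  refine h1.union h2 (fun x hx => ?_) (fun x hx => ?_)
  · have : 0 < x 1 := hx.2
    simp [jumpA, this]
  · have : ¬ 0 < x 1 := not_lt.mpr hx.2
    simp [jumpA, this]

/-- **Continuity of the Green coefficients up to `∂Δ` is load-bearing in `stub_greenInRelations`.**
With interior continuity plus boundedness only, `A = 𝟙{b = 0}`, `B = 0`, `S = 0` satisfy every
clause (`A = 0` inside, so `dS = 0 = A da + B db` there), and the generator is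
`[∫₀¹ 1] + [∫₀¹ 0] − [∫₀¹ 0]`, of value `1 ≠ 0`: not a relation, by soundness of the calculus. -/
theorem not_greenInteriorContinuity : ¬ GreenInteriorContinuity := by
  intro h
  have hT : IsSemialgebraic ℚ {p : Fin 2 → ℝ | 0 ≤ p 0 ∧ 0 ≤ p 1 ∧ p 0 + p 1 ≤ 1} :=
    isSemialgebraic_closedTriangle'
  have hmem := h (KZ.of (constRep₁ 1) + KZ.of (constRep₁ 0) - KZ.of (constRep₁ 0))
    ⟨_, jumpA, fun _ => 0, fun _ => 0, constRep₁ 1, constRep₁ 0, constRep₁ 0, rfl,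
      isSemialgebraicFunOn_jumpA, by simpa using isSemialgebraicFunOn_natCast hT 0,
      (continuousOn_const (c := (0 : ℝ))).congr (fun p hp => by
        have hp1 : 0 < p 1 := hp.2.1
        simp [jumpA, hp1]), continuousOn_const,
      ⟨1, fun p _ => ⟨by unfold jumpA; split_ifs <;> simp, by simp⟩⟩,
      fun p _ hp1 _ => by
        have hA : jumpA p = 0 := by simp [jumpA, hp1]
        rw [hA, zero_smul, zero_smul, add_zero]
        exact hasFDerivAt_const 0 p,
      rfl, rfl, rfl,
      fun z _ => by simp [jumpA],
      fun z hz => by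
        have hz' : 0 < z 0 := hz.1
        simp [jumpA, hz'],
      fun z _ => by simp, rfl⟩
  have h0 := KZ.relations_le_ker_eval_holds hmem
  rw [AddMonoidHom.mem_ker, map_sub, map_add, KZ.eval_of, KZ.eval_of, value_constRep₁,
    value_constRep₁] at h0
  norm_num at h0

end Summit.KontsevichZagierPeriods.PlanarAreas.Negative.GreenBands

end
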